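import Mathlib
import Summits.ValiantsHypothesis.ValiantsHypothesis.Theorems.DivisionGapPerCofactorDegreeReductionStubTwoTowerCollapse

/-!
# Crux `DivisionGap.PerCofactorDegreeReduction` (stmt-ValiantsHypothesis-15046), line `Sketch` —
# stub `stub_hiddenRankOne`: balanced creation identities modulo the permanent are hidden rank one

**Theorem (`stub_hiddenRankOne`).** Let `n ≥ 3` and let `a₁, a₂, b₁, b₂ ∈ ℝ≥0[x_ij]` (`n × n`
variables) be homogeneous of the same degree `d`, none of them divisible by `per_n` over `ℝ`, with
`per_n ∣ a₁ a₂ + b₁ b₂` over `ℝ`.  If no cross pair is antipodal — `per_n ∤ a₁ + c b₁`,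
`per_n ∤ a₂ + c b₁`, `per_n ∤ b₂ + c a₁`, `per_n ∤ b₂ + c a₂` over `ℝ` for every real `c > 0` — then
in `S_n = ℂ[x]/(per_n)` there are NON-UNITS `s, t, u, v` with `ā₁ = s t`, `b̄₁ = s u`, `ā₂ = u v`,
`b̄₂ = -(t v)` (bars: classes of the complexifications).

## Proof

Work in `S = ℂ[x]/(per_n)`, a domain and a UFD for `n ≥ 3` (tree theorem
`Summit.ValiantsHypothesis.Theorems.permQuot_isDomain_and_ufm`), graded by total degree
(`Literature.RingTheory.GradedAlgebra.quotGrading`) with degree-`0` part `ℂ`; the four classes are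
nonzero (descent of divisibility from `ℂ` to `ℝ`, `TwoTowerCollapse.per_descent`) and homogeneous
of degree `d`, and `ā₁ ā₂ + b̄₁ b̄₂ = 0`.
* §1 *Algebra.* With the GCD structure of the UFD (`UniqueFactorizationMonoid.toGCDMonoid`,
  `extract_gcd`): `s := gcd(ā₁, b̄₁)`, `ā₁ = s t`, `b̄₁ = s u`, `gcd(t, u)` a unit.  Cancelling
  `s ≠ 0` in `s (t ā₂ + u b̄₂) = 0` gives `t ā₂ = -u b̄₂`, so `u ∣ t ā₂` and, `t, u` being
  relatively prime, `u ∣ ā₂`: `ā₂ = u v`; cancelling `u ≠ 0` in `u (t v + b̄₂) = 0` gives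
  `b̄₂ = -(t v)`.
* §2 *Degrees.* In a graded domain a divisor `x` of a nonzero homogeneous `y` of the SAME degree
  differs from it by a factor of degree `0` (the cofactor is homogeneous —
  `Literature.RingTheory.RegularLocalRing.isHomogeneousElem_of_mul_mem` — and degrees add), i.e.
  `y = c x` for a constant `c ≠ 0` (`exists_mem_zero_of_dvd`).
* §3 *Non-units.* If one of `s, t, u, v` is a unit, two members of a cross pair divide one another:
  `t` a unit ⇒ `ā₁ ∣ b̄₁`; `u` a unit ⇒ `b̄₁ ∣ ā₁`; `s` a unit ⇒ `ā₁ ∣ b̄₂`; `v` a unit ⇒ `ā₂ ∣ b̄₁`.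
  By §2 the pair is `X̄₁ = c Ȳ₁` with `c ≠ 0`, and the relation reads `X̄₁ X̄₂ + Ȳ₁ Ȳ₂ = 0` for
  the complementary pair.  Then `c ∈ ℝ` (else `per_n ∣ Y₁` over `ℝ`, imaginary parts:
  `TwoTowerCollapse.dvd_of_map_dvd_sub_C_mul`); `c < 0` gives `per_n ∣ X₁ + |c| Y₁`, and `c > 0`
  gives `Ȳ₁ (c X̄₂ + Ȳ₂) = 0`, `per_n ∣ Y₂ + c X₂` — an excluded antipodal cross pair either way.
The hypothesis `per_n ∤ a₂` of the registered signature is not needed (it follows from the others).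
-/

noncomputable section

-- `Summit.ValiantsHypothesis.ValiantsHypothesis.…` is the tree's mandated single-conjunct layout
-- (Problem = Summit), so the duplicated namespace component is intended.
set_option linter.dupNamespace false

namespace Summit.ValiantsHypothesis.ValiantsHypothesis.Theorems.DivisionGap.PerCofactorDegreeReduction.HiddenRankOne

open MvPolynomial Literature.Computability.AlgebraicComplexity
open Summit.ValiantsHypothesis.ValiantsHypothesis.Theorems.DivisionGap.PerCofactorDegreeReduction.TwoTowerCollapse
  (per_descent per_ascent dvd_of_map_dvd_sub_C_mul)
open scoped NNReal

/-! ### §2 Graded domains: a same-degree divisor differs by a degree-zero factor -/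

section Graded

open DirectSum SetLike Literature.RingTheory.RegularLocalRing

/-- **Same-degree divisibility in a graded domain.** In an `ℕ`-graded domain (grading by
submodules), if `x ∣ y` with `x`, `y` homogeneous of the same degree `d` and `y ≠ 0`, then
`y = w x` with `w` homogeneous of degree `0`: the cofactor `w` is homogeneous as a divisor of a
nonzero homogeneous element, and `d + deg w = d`.  The grading by submodules is re-bundled as the
same grading by additive subgroups. [folklore] -/
theorem exists_mem_zero_of_dvd {R B : Type*} [CommRing R] [CommRing B] [Algebra R B] [IsDomain B]
    (ℬ : ℕ → Submodule R B) [GradedAlgebra ℬ] {x y : B} {d : ℕ} (hx : x ∈ ℬ d) (hy : y ∈ ℬ d)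
    (hy0 : y ≠ 0) (hxy : x ∣ y) : ∃ w ∈ ℬ 0, y = w * x := by
  classical
  obtain ⟨w, rfl⟩ := hxy
  -- the same grading, by additive subgroups
  let 𝒜 : ℕ → AddSubgroup B := fun i => (ℬ i).toAddSubgroup
  letI : GradedRing 𝒜 :=
    { one_mem := (SetLike.GradedOne.one_mem : (1 : B) ∈ ℬ 0)
      mul_mem := fun _ _ _ _ ha hb => SetLike.GradedMul.mul_mem (A := ℬ) ha hb
      decompose' := DirectSum.decompose ℬ
      left_inv := (DirectSum.decompose ℬ).left_inv
      right_inv := (DirectSum.decompose ℬ).right_inv }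
  obtain ⟨e, he⟩ := isHomogeneousElem_of_mul_mem 𝒜 (x := w) (y := x) (d := d)
    (by rwa [mul_comm]) (by rwa [mul_comm])
  have he' : w ∈ ℬ e := he
  have hde : x * w ∈ ℬ (d + e) := SetLike.mul_mem_graded hx he'
  have h := DirectSum.degree_eq_of_mem_mem ℬ hy hde hy0
  have he0 : e = 0 := by omega
  exact ⟨w, he0 ▸ he', mul_comm x w⟩

end Graded

/-! ### §3 The theorem -/

/-- **stub_hiddenRankOne — BALANCED CREATION IDENTITIES are hidden rank one modulo the
permanent.**  For `n ≥ 3`, homogeneous `a₁, a₂, b₁, b₂ ∈ ℝ≥0[x_ij]` of one degree `d`, none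
divisible by `per_n` over `ℝ`, with `per_n ∣ a₁ a₂ + b₁ b₂` over `ℝ` and no antipodal cross pair
(`per_n ∤ a₁ + c b₁, a₂ + c b₁, b₂ + c a₁, b₂ + c a₂` for all real `c > 0`), there are non-units
`s, t, u, v` of `S_n = ℂ[x]/(per_n)` with `ā₁ = s t`, `b̄₁ = s u`, `ā₂ = u v`, `b̄₂ = -(t v)`.
Proof in the graded UFD `S_n` (`Summit.ValiantsHypothesis.Theorems.permQuot_isDomain_and_ufm`):
`s = gcd(ā₁, b̄₁)` (`extract_gcd`), coprime cancellation gives `ā₂ = u v`, `b̄₂ = -(t v)`; if one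
of the four were a unit, two members of a cross pair of the same degree would divide one another,
hence differ by a nonzero constant (`exists_mem_zero_of_dvd`), real by descent of divisibility
(imaginary parts), whose sign produces an excluded antipodal cross pair.  The hypothesis
`per_n ∤ a₂` is part of the registered signature but unused. [abc-tower-collapse, Lever;
prime-walk-positivizer] -/
theorem stub_hiddenRankOne (n d : ℕ) (hn : 3 ≤ n)
    (a₁ a₂ b₁ b₂ : MvPolynomial (Fin n × Fin n) ℝ≥0)
    (ha₁ : a₁.IsHomogeneous d) (ha₂ : a₂.IsHomogeneous d)
    (hb₁ : b₁.IsHomogeneous d) (hb₂ : b₂.IsHomogeneous d)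
    (hdvd : perPoly (Fin n) ℝ ∣ MvPolynomial.map NNReal.toRealHom (a₁ * a₂ + b₁ * b₂))
    (hna₁ : ¬ perPoly (Fin n) ℝ ∣ MvPolynomial.map NNReal.toRealHom a₁)
    (hna₂ : ¬ perPoly (Fin n) ℝ ∣ MvPolynomial.map NNReal.toRealHom a₂)
    (hnb₁ : ¬ perPoly (Fin n) ℝ ∣ MvPolynomial.map NNReal.toRealHom b₁)
    (hnb₂ : ¬ perPoly (Fin n) ℝ ∣ MvPolynomial.map NNReal.toRealHom b₂)
    (hcross : ∀ c : ℝ≥0, 0 < c →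
      ¬ perPoly (Fin n) ℝ ∣ MvPolynomial.map NNReal.toRealHom (a₁ + c • b₁) ∧
      ¬ perPoly (Fin n) ℝ ∣ MvPolynomial.map NNReal.toRealHom (a₂ + c • b₁) ∧
      ¬ perPoly (Fin n) ℝ ∣ MvPolynomial.map NNReal.toRealHom (b₂ + c • a₁) ∧
      ¬ perPoly (Fin n) ℝ ∣ MvPolynomial.map NNReal.toRealHom (b₂ + c • a₂)) :
    ∃ s t u v : MvPolynomial (Fin n × Fin n) ℂ ⧸ Ideal.span {perPoly (Fin n) ℂ},
      ¬ IsUnit s ∧ ¬ IsUnit t ∧ ¬ IsUnit u ∧ ¬ IsUnit v ∧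
      Ideal.Quotient.mk (Ideal.span {perPoly (Fin n) ℂ})
          (MvPolynomial.map Complex.ofRealHom (MvPolynomial.map NNReal.toRealHom a₁)) = s * t ∧
      Ideal.Quotient.mk (Ideal.span {perPoly (Fin n) ℂ})
          (MvPolynomial.map Complex.ofRealHom (MvPolynomial.map NNReal.toRealHom b₁)) = s * u ∧
      Ideal.Quotient.mk (Ideal.span {perPoly (Fin n) ℂ})
          (MvPolynomial.map Complex.ofRealHom (MvPolynomial.map NNReal.toRealHom a₂)) = u * v ∧
      Ideal.Quotient.mk (Ideal.span {perPoly (Fin n) ℂ})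
          (MvPolynomial.map Complex.ofRealHom (MvPolynomial.map NNReal.toRealHom b₂)) = -(t * v) := by
  classical
  -- `hna₂` belongs to the registered signature but is not needed
  have _ := hna₂
  -- `S_n = ℂ[x]/(per_n)`: a domain and a UFD, graded by total degree, degree-0 part `ℂ`
  obtain ⟨hdom, hufm⟩ := Summit.ValiantsHypothesis.Theorems.permQuot_isDomain_and_ufm hn
  letI := MvPolynomial.gradedAlgebra (σ := Fin n × Fin n) (R := ℂ)
  have hhom : (Ideal.span {perPoly (Fin n) ℂ}).IsHomogeneous
      (homogeneousSubmodule (Fin n × Fin n) ℂ) :=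
    Ideal.homogeneous_span _ _ fun x hx => by
      rw [Set.mem_singleton_iff] at hx
      subst hx
      exact ⟨_, (mem_homogeneousSubmodule _ _).2 perPoly_isHomogeneous⟩
  letI : GradedAlgebra (Literature.RingTheory.GradedAlgebra.quotGrading
      (homogeneousSubmodule (Fin n × Fin n) ℂ) (Ideal.span {perPoly (Fin n) ℂ})) :=
    Literature.RingTheory.GradedAlgebra.quotGrading.gradedAlgebra
      (homogeneousSubmodule (Fin n × Fin n) ℂ) ⟨Ideal.span {perPoly (Fin n) ℂ}, hhom⟩
  -- the reduction map `Φ : ℝ≥0[x] → ℝ[x] → ℂ[x] → S_n`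
  obtain ⟨Φ, hΦdef⟩ : ∃ Φ : MvPolynomial (Fin n × Fin n) ℝ≥0 →+*
      MvPolynomial (Fin n × Fin n) ℂ ⧸ Ideal.span {perPoly (Fin n) ℂ},
      Φ = (Ideal.Quotient.mk (Ideal.span {perPoly (Fin n) ℂ})).comp
        ((MvPolynomial.map Complex.ofRealHom).comp (MvPolynomial.map NNReal.toRealHom)) :=
    ⟨_, rfl⟩
  have hΦ : ∀ p, Φ p = Ideal.Quotient.mk (Ideal.span {perPoly (Fin n) ℂ})
      (MvPolynomial.map Complex.ofRealHom (MvPolynomial.map NNReal.toRealHom p)) := fun p => by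
    rw [hΦdef]; rfl
  have hΦ0 : ∀ p, Φ p = 0 ↔ perPoly (Fin n) ℂ ∣
      MvPolynomial.map Complex.ofRealHom (MvPolynomial.map NNReal.toRealHom p) := fun p => by
    rw [hΦ, Ideal.Quotient.eq_zero_iff_mem, Ideal.mem_span_singleton]
  have hΦC : ∀ (b : ℝ≥0) (p : MvPolynomial (Fin n × Fin n) ℝ≥0),
      Φ (b • p) = Ideal.Quotient.mk (Ideal.span {perPoly (Fin n) ℂ}) (C ((b : ℝ) : ℂ)) * Φ p := by
    intro b p
    simp only [hΦ, smul_eq_C_mul, map_mul, MvPolynomial.map_C]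
    rfl
  -- homogeneous of degree `d` stays homogeneous of degree `d` in `S_n`
  have hmem : ∀ V : MvPolynomial (Fin n × Fin n) ℝ≥0, V.IsHomogeneous d →
      Φ V ∈ Literature.RingTheory.GradedAlgebra.quotGrading
        (homogeneousSubmodule (Fin n × Fin n) ℂ) (Ideal.span {perPoly (Fin n) ℂ}) d :=
    fun V hV => by
      rw [hΦ]
      exact Literature.RingTheory.GradedAlgebra.mk_mem_quotGrading
        ((mem_homogeneousSubmodule _ _).2 ((hV.map _).map _))
  -- the relation in `S_n` and the non-vanishing of `ā₁`, `b̄₁`, `b̄₂`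
  have hrel : Φ a₁ * Φ a₂ + Φ b₁ * Φ b₂ = 0 := by
    rw [← map_mul, ← map_mul, ← map_add, hΦ0]
    exact per_ascent hdvd
  have hA₁ : Φ a₁ ≠ 0 := fun h => hna₁ (per_descent ((hΦ0 a₁).1 h))
  have hB₁ : Φ b₁ ≠ 0 := fun h => hnb₁ (per_descent ((hΦ0 b₁).1 h))
  have hB₂ : Φ b₂ ≠ 0 := fun h => hnb₂ (per_descent ((hΦ0 b₂).1 h))
  -- §2: same-degree divisibility in `S_n` is by a nonzero constant
  have hkey : ∀ {x y : MvPolynomial (Fin n × Fin n) ℂ ⧸ Ideal.span {perPoly (Fin n) ℂ}},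
      x ∈ Literature.RingTheory.GradedAlgebra.quotGrading
        (homogeneousSubmodule (Fin n × Fin n) ℂ) (Ideal.span {perPoly (Fin n) ℂ}) d →
      y ∈ Literature.RingTheory.GradedAlgebra.quotGrading
        (homogeneousSubmodule (Fin n × Fin n) ℂ) (Ideal.span {perPoly (Fin n) ℂ}) d →
      y ≠ 0 → x ∣ y →
      ∃ c : ℂ, c ≠ 0 ∧ y = Ideal.Quotient.mk (Ideal.span {perPoly (Fin n) ℂ}) (C c) * x := by
    intro x y hx hy hy0 hxy
    obtain ⟨w, hw0, hw⟩ := exists_mem_zero_of_dvd _ hx hy hy0 hxy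
    obtain ⟨a, ha, rfl⟩ := Literature.RingTheory.GradedAlgebra.mem_quotGrading_iff.1 hw0
    rw [mem_homogeneousSubmodule] at ha
    obtain ⟨c, rfl⟩ : ∃ c : ℂ, a = C c :=
      ⟨coeff 0 a, totalDegree_eq_zero_iff_eq_C.mp ((totalDegree_zero_iff_isHomogeneous _).mpr ha)⟩
    refine ⟨c, ?_, hw⟩
    rintro rfl
    apply hy0
    rw [hw, C_0, map_zero, zero_mul]
  have hflip : ∀ {x y : MvPolynomial (Fin n × Fin n) ℂ ⧸ Ideal.span {perPoly (Fin n) ℂ}} {c : ℂ},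
      c ≠ 0 → y = Ideal.Quotient.mk (Ideal.span {perPoly (Fin n) ℂ}) (C c) * x →
      x = Ideal.Quotient.mk (Ideal.span {perPoly (Fin n) ℂ}) (C c⁻¹) * y := by
    intro x y c hc0 hxy
    rw [hxy, ← mul_assoc, ← map_mul, ← map_mul, inv_mul_cancel₀ hc0, map_one, map_one, one_mul]
  -- §3: a constant proportionality inside a cross pair contradicts `hcross`
  have hfin : ∀ (X₁ Y₁ X₂ Y₂ : MvPolynomial (Fin n × Fin n) ℝ≥0) (c : ℂ), c ≠ 0 →
      Φ X₁ = Ideal.Quotient.mk (Ideal.span {perPoly (Fin n) ℂ}) (C c) * Φ Y₁ →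
      Φ X₁ * Φ X₂ + Φ Y₁ * Φ Y₂ = 0 →
      ¬ perPoly (Fin n) ℝ ∣ MvPolynomial.map NNReal.toRealHom Y₁ →
      (∀ e : ℝ≥0, 0 < e →
        ¬ perPoly (Fin n) ℝ ∣ MvPolynomial.map NNReal.toRealHom (X₁ + e • Y₁)) →
      (∀ e : ℝ≥0, 0 < e →
        ¬ perPoly (Fin n) ℝ ∣ MvPolynomial.map NNReal.toRealHom (Y₂ + e • X₂)) → False := by
    intro X₁ Y₁ X₂ Y₂ c hc0 hXY hrelXY hY₁ h1 h2
    have hY₁0 : Φ Y₁ ≠ 0 := fun h => hY₁ (per_descent ((hΦ0 Y₁).1 h))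
    -- `per_n ∣ X₁ - c Y₁` over `ℂ`
    have hdiv : perPoly (Fin n) ℂ ∣
        MvPolynomial.map Complex.ofRealHom (MvPolynomial.map NNReal.toRealHom X₁) -
          C c * MvPolynomial.map Complex.ofRealHom (MvPolynomial.map NNReal.toRealHom Y₁) := by
      rw [← Ideal.mem_span_singleton, ← Ideal.Quotient.eq_zero_iff_mem, map_sub, map_mul, ← hΦ,
        ← hΦ, hXY, sub_self]
    -- `c` is real: otherwise `per_n ∣ Y₁`
    have hcim : c.im = 0 := by
      by_contra hcim
      exact hY₁ (dvd_of_map_dvd_sub_C_mul (r := MvPolynomial.map NNReal.toRealHom X₁) hcim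
        (by rwa [map_perPoly]))
    have hc : c = ((c.re : ℝ) : ℂ) := Complex.ext (by simp) (by simp [hcim])
    have hre0 : c.re ≠ 0 := by
      intro hre0
      apply hc0
      rw [hc, hre0, Complex.ofReal_zero]
    rcases lt_or_gt_of_ne hre0 with hneg | hpos
    · -- `c < 0`: `X̄₁ + |c| Ȳ₁ = 0`
      obtain ⟨b, hb0, hb⟩ : ∃ b : ℝ≥0, 0 < b ∧ ((b : ℝ) : ℂ) = -c :=
        ⟨NNReal.mk (-c.re) (by linarith), NNReal.coe_pos.1 (show (0 : ℝ) < -c.re by linarith), by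
          rw [NNReal.coe_mk, Complex.ofReal_neg, ← hc]⟩
      refine h1 b hb0 (per_descent ((hΦ0 _).1 ?_))
      rw [map_add, hΦC, hb, hXY, ← add_mul, ← map_add, ← map_add, add_neg_cancel, map_zero,
        map_zero, zero_mul]
    · -- `c > 0`: `Ȳ₁ (c X̄₂ + Ȳ₂) = 0`, so `Ȳ₂ + c X̄₂ = 0`
      have hk : Φ Y₁ * (Ideal.Quotient.mk (Ideal.span {perPoly (Fin n) ℂ}) (C c) * Φ X₂ + Φ Y₂) =
          0 := by
        rw [← hrelXY, hXY]
        ring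
      have hk' := (mul_eq_zero.1 hk).resolve_left hY₁0
      obtain ⟨b, hb0, hb⟩ : ∃ b : ℝ≥0, 0 < b ∧ ((b : ℝ) : ℂ) = c :=
        ⟨NNReal.mk c.re hpos.le, NNReal.coe_pos.1 (show (0 : ℝ) < c.re from hpos), by
          rw [NNReal.coe_mk, ← hc]⟩
      refine h2 b hb0 (per_descent ((hΦ0 _).1 ?_))
      rw [map_add, hΦC, hb, add_comm]
      exact hk'
  -- §1: the gcd structure of the UFD `S_n`
  letI := UniqueFactorizationMonoid.toGCDMonoid
    (MvPolynomial (Fin n × Fin n) ℂ ⧸ Ideal.span {perPoly (Fin n) ℂ})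
  obtain ⟨t, u, hst, hsu, htu⟩ := extract_gcd (Φ a₁) (Φ b₁)
  obtain ⟨s, hs⟩ : ∃ s, gcd (Φ a₁) (Φ b₁) = s := ⟨_, rfl⟩
  rw [hs] at hst hsu
  have hs0 : s ≠ 0 := fun h => hA₁ (by rw [hst, h, zero_mul])
  have hu0 : u ≠ 0 := fun h => hB₁ (by rw [hsu, h, mul_zero])
  -- `t ā₂ + u b̄₂ = 0`
  have htu2 : t * Φ a₂ + u * Φ b₂ = 0 := by
    have h : s * (t * Φ a₂ + u * Φ b₂) = 0 := by
      rw [mul_add, ← mul_assoc, ← mul_assoc, ← hst, ← hsu, hrel]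
    exact (mul_eq_zero.1 h).resolve_left hs0
  -- `u ∣ ā₂` by coprimality: `ā₂ = u v`
  have hudvd : u ∣ Φ a₂ := by
    have h1 : u ∣ t * Φ a₂ := ⟨-Φ b₂, by linear_combination htu2⟩
    exact (gcd_isUnit_iff_isRelPrime.1 htu).symm.dvd_of_dvd_mul_left h1
  obtain ⟨v, huv⟩ := hudvd
  -- `b̄₂ = -(t v)`
  have htv : Φ b₂ = -(t * v) := by
    have h : u * (t * v + Φ b₂) = 0 := by
      rw [← htu2, huv]
      ring
    exact eq_neg_of_add_eq_zero_right ((mul_eq_zero.1 h).resolve_left hu0)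
  refine ⟨s, t, u, v, ?_, ?_, ?_, ?_, (hΦ a₁).symm.trans hst, (hΦ b₁).symm.trans hsu,
    (hΦ a₂).symm.trans huv, (hΦ b₂).symm.trans htv⟩
  · -- `s` a unit: `ā₁ ∣ b̄₂`
    intro hsU
    have hd : Φ a₁ ∣ Φ b₂ := by
      rw [hst, hsU.mul_left_dvd, htv]
      exact (dvd_neg).2 (dvd_mul_right t v)
    obtain ⟨c, hc0, hc⟩ := hkey (hmem a₁ ha₁) (hmem b₂ hb₂) hB₂ hd
    exact hfin b₂ a₁ b₁ a₂ c hc0 hc (by linear_combination hrel) hna₁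
      (fun e he => (hcross e he).2.2.1) (fun e he => (hcross e he).2.1)
  · -- `t` a unit: `ā₁ ∣ b̄₁`
    intro htU
    have hd : Φ a₁ ∣ Φ b₁ := by
      rw [hst, htU.mul_right_dvd, hsu]
      exact dvd_mul_right s u
    obtain ⟨c, hc0, hc⟩ := hkey (hmem a₁ ha₁) (hmem b₁ hb₁) hB₁ hd
    exact hfin a₁ b₁ a₂ b₂ c⁻¹ (inv_ne_zero hc0) (hflip hc0 hc) hrel hnb₁
      (fun e he => (hcross e he).1) (fun e he => (hcross e he).2.2.2)
  · -- `u` a unit: `b̄₁ ∣ ā₁`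
    intro huU
    have hd : Φ b₁ ∣ Φ a₁ := by
      rw [hsu, huU.mul_right_dvd, hst]
      exact dvd_mul_right s t
    obtain ⟨c, hc0, hc⟩ := hkey (hmem b₁ hb₁) (hmem a₁ ha₁) hA₁ hd
    exact hfin a₁ b₁ a₂ b₂ c hc0 hc hrel hnb₁
      (fun e he => (hcross e he).1) (fun e he => (hcross e he).2.2.2)
  · -- `v` a unit: `ā₂ ∣ b̄₁`
    intro hvU
    have hd : Φ a₂ ∣ Φ b₁ := by
      rw [huv, hvU.mul_right_dvd, hsu]
      exact dvd_mul_left u s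
    obtain ⟨c, hc0, hc⟩ := hkey (hmem a₂ ha₂) (hmem b₁ hb₁) hB₁ hd
    exact hfin a₂ b₁ a₁ b₂ c⁻¹ (inv_ne_zero hc0) (hflip hc0 hc) (by linear_combination hrel) hnb₁
      (fun e he => (hcross e he).2.1) (fun e he => (hcross e he).2.2.1)

end Summit.ValiantsHypothesis.ValiantsHypothesis.Theorems.DivisionGap.PerCofactorDegreeReduction.HiddenRankOne

end
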